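import Literature.MathematicalPhysics.QuantumFieldTheory.Balaban1983to89.Node00.MultiScaleFibreChartLocality
import Literature.MathematicalPhysics.QuantumFieldTheory.Balaban1983to89.B16Ineq19NearFlatSliceNorms

/-!
# DAG node N12 [B15] — BOOKKEEPING FOR THE CHART LETTER (χ) OF THE NEAR-FLAT PACKAGE (N): (χ)'s two near-flatness letters make `U₀` GLOBALLY near-flat (Γ₀ = Ω₁ᶜ), and the junction's
# seminorm `p := bond-ℓ²(HS)` as an explicit `Seminorm` term with its four letters

[Balaban1988Convergent] = «[III]», (2.2) p. 255 («Γ₀ = Ωᶜ₁, Γ_j = Ω_j^{(j)}∖Ω^{(j)}_{j+1}, …, Γ_k = Ω_k^{(k)}»), (2.10)–(2.13) pp. 256–257; [Balaban1989LargeFieldII] = «[LF-II]», p. 357, (1.7) p. 358,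
(1.13) p. 359, (17)–(19) pp. 360–361; [Balaban1985Averaging], (17)–(19) pp. 20–21.

Cell `pub-ymgap`, HUMAN RULINGS D-0062 ∕ D-0149, width seat `pub-ymgap-dag-n12-w4` generation 4 (WIDTH SEAT 4 of 4 on N12; INBOX CLAIM-1 ∕ INTENT-1 of 2026-08-28 l.36204).  Key K1⁹
`stmt-QuantumFields-27364` (KEY MAP v2), `--kind proof --supports stmt-QuantumFields-27364 --as helper`; count-neutral.  NEW leaf (file 1 of 2 of the CLAIM; file 2 =
`…N12NearFlatChartLetter`, the assembled letter (χ)).  CONSUMED BY NAME, nothing modified: `B14.Eq213DetSet.Bj_zero` (r11∕r12), `B14.Eq216Concrete.inputs` ∕ `feeds_zero`,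
dag-n12-w2's `B16Ineq19NearFlatSliceNorms.opNorm_coe_le_norm_lieSU` ∕ `sum_opNorm_coe_sq_le_sum_norm_sq`.

WHY.  The letter (χ) of dag-n12-w5's junction `B15Prop1NearFlatPackageFromLetters.nearFlatPackage_of_letters` (p625120) hands its producer a (2.12)-minimiser `U₀` with TWO near-flatness
letters: C1 — `δc`-near `1` on the four bonds of every plaquette having a bond sourced in `Ω₁(Z) = maxDomT ν.M₁ Z 1` (the Wilson side's currency) — and Cin — `δin`-near `1` on
`inputs 𝐁_k(Z)` (the chart side's).  By [III] (2.2) the finest member of the determining set of record is `Γ₀ = Ω₁ᶜ` (`Bj_zero`): EVERY fine bond not sourced in `Ω₁` meets `Γ₀`, hence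
lies in `bondsOf (𝐁_k(Z) 0) ⊆ inputs 𝐁_k(Z)` (`feeds_zero`); every bond sourced in `Ω₁` is the `⟨p.src, p.μ⟩`- or `⟨p.src, p.ν⟩`-bond of a plaquette of C1's kind (`2 ≤ d`).  So
`‖↑(U₀ b) − 1‖ ≤ max δc δin` for EVERY bond — (χ)'s `U₀` is GLOBALLY near-flat in dag-n10-w1's sup currency, and the GLOBAL editions of every chart-side letter of this lineage apply
verbatim (file 2).  §2 fixes the junction's seminorm `p` of J-C's package (N) as the bond-`ℓ²` Hilbert–Schmidt seminorm, written as an explicit `Seminorm` TERM (the `PiLp 2` norm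
through the `WithLp` identification — no definition is introduced), with the four letters file 2 needs: J-C's `hp`, the `ℓ¹(op)` size of the current letter, the comparison with the
sup norm, and (K) from a per-bond bound plus a support letter.

CONTENTS (namespace `Summit.QuantumFields.YangMills.BalabanUVNodes.N12NearFlatChartLetter`; theorems only — no `def`, no `instance`, no `sorry`).
* §1 `exists_plaq_fst_or_fourth`, ★ `norm_sub_one_le_of_plaqNear_of_inputs` (THE OBSERVATION), `norm_coeField_sub_one_le`.
* §2 `l2Seminorm_apply`, `l2Seminorm_sq`, `sum_opNorm_sq_le_l2Seminorm_sq` (J-C's `hp`), `sum_opNorm_le_sqrt_card_mul_l2Seminorm`, `l2Seminorm_le_sqrt_card_mul_norm`,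
  `l2Seminorm_le_of_bound_of_support`.

HONEST FRAMING.  Lattice bookkeeping and finite-dimensional norm comparisons; nothing of Bałaban's asserted; count-neutral helper; N12 NOT discharged; K1⁹ NOT closed; counts unmoved
(5∕27); one finite 𝕋⁴ programme at fixed ε — R4 closes the conditional finite-𝕋⁴ rung `BalabanLadder.UV` only; NOT continuum ∕ ℝ⁴ ∕ OS ∕ mass gap ∕ Clay.
-/

noncomputable section

open scoped BigOperators Matrix.Norms.L2Operator
open Finset

namespace Summit.QuantumFields.YangMills.BalabanUVNodes.N12NearFlatChartLetter

open Literature.MathematicalPhysics.QuantumFieldTheory.Balaban1983to89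
open T4Continuum (T4Family)
open T4AdjointCovarianceUnitary (lieSU)
open T4CubeChartGnomonic (SU2)
open B15DeterminingSets GaugeField
open B14.Eq213DetSet (Bj Bj_zero maxDomT)
open B14.Eq216Concrete (inputs mem_inputs feeds_zero)
open Node00
open B16Ineq19NearFlatSliceNorms (opNorm_coe_le_norm_lieSU sum_opNorm_coe_sq_le_sum_norm_sq)

variable {F : T4Family} {Kt : ℕ}

/-! ## §1  The observation: (χ)'s two near-flatness letters make `U₀` globally near-flat -/

/-- In dimension `d ≥ 2` every bond `b` is the `⟨p.src, p.μ⟩`-bond or the `⟨p.src, p.ν⟩`-bond of some plaquette `p` based at `b.src`. [cite: Balaban1988Convergent, (2.2) p.255 (bookkeeping)] -/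
theorem exists_plaq_fst_or_fourth {j : ℕ} (h2 : 2 ≤ (F.P Kt).d) (b : PBond (F.P Kt) j) :
    ∃ p : Plaq (F.P Kt) j, p.src = b.src ∧ (p.μ = b.dir ∨ p.ν = b.dir) := by
  by_cases h : b.dir.val + 1 < (F.P Kt).d
  · exact ⟨⟨b.src, b.dir, ⟨b.dir.val + 1, h⟩, Fin.lt_def.2 (Nat.lt_succ_self _)⟩, rfl, Or.inl rfl⟩
  · have h0 : 0 < b.dir.val := by have := b.dir.isLt; omega
    exact ⟨⟨b.src, ⟨0, by omega⟩, b.dir, Fin.lt_def.2 h0⟩, rfl, Or.inr rfl⟩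

/-- ★ **THE OBSERVATION.**  Let `0 < k` and `2 ≤ d`.  If `U₀` is `δc`-near `1` on the four bonds of every plaquette having a bond sourced in `Ω₁(Z) = maxDomT M₁ Z 1` (the letter C1 of (χ))
and `δin`-near `1` on `inputs (Bj M₁ Z k)` (the letter Cin of (χ)), then `U₀` is `max δc δin`-near `1` on EVERY bond: a bond sourced in `Ω₁` is the first or fourth bond of a plaquette of
C1's kind; a bond not sourced in `Ω₁` meets `Γ₀ = Ω₁ᶜ` ([III] (2.2), `Bj_zero`) and so lies in `bondsOf (Bj M₁ Z k 0) ⊆ inputs (Bj M₁ Z k)` (`feeds_zero`).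
[cite: Balaban1988Convergent, (2.2) p.255, (2.10)–(2.11) p.256, (2.13) pp.256–257; Balaban1989LargeFieldII, p.357] -/
theorem norm_sub_one_le_of_plaqNear_of_inputs (h2 : 2 ≤ (F.P Kt).d) {k : ℕ} (hk0 : 0 < k) (M₁ : ℕ) (Z : Set (Site (F.P Kt) 0))
    {U₀ : GaugeField (F.P Kt) 0 SU2} {δc δin : ℝ}
    (hC1 : ∀ p : Plaq (F.P Kt) 0, ((⟨p.src, p.μ⟩ : PBond (F.P Kt) 0) ∈ {b : PBond (F.P Kt) 0 | b.src ∈ maxDomT M₁ Z 1} ∨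
        (⟨p.src.shift p.μ, p.ν⟩ : PBond (F.P Kt) 0) ∈ {b : PBond (F.P Kt) 0 | b.src ∈ maxDomT M₁ Z 1} ∨
        (⟨p.src.shift p.ν, p.μ⟩ : PBond (F.P Kt) 0) ∈ {b : PBond (F.P Kt) 0 | b.src ∈ maxDomT M₁ Z 1} ∨
        (⟨p.src, p.ν⟩ : PBond (F.P Kt) 0) ∈ {b : PBond (F.P Kt) 0 | b.src ∈ maxDomT M₁ Z 1}) →
      ‖((U₀ ⟨p.src, p.μ⟩ : SU2) : Matrix (Fin 2) (Fin 2) ℂ) - 1‖ ≤ δc ∧ ‖((U₀ ⟨p.src.shift p.μ, p.ν⟩ : SU2) : Matrix (Fin 2) (Fin 2) ℂ) - 1‖ ≤ δc ∧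
        ‖((U₀ ⟨p.src.shift p.ν, p.μ⟩ : SU2) : Matrix (Fin 2) (Fin 2) ℂ) - 1‖ ≤ δc ∧ ‖((U₀ ⟨p.src, p.ν⟩ : SU2) : Matrix (Fin 2) (Fin 2) ℂ) - 1‖ ≤ δc)
    (hCin : ∀ b ∈ inputs (Bj M₁ Z k), ‖((U₀ b : SU2) : Matrix (Fin 2) (Fin 2) ℂ) - 1‖ ≤ δin) :
    ∀ b : PBond (F.P Kt) 0, ‖((U₀ b : SU2) : Matrix (Fin 2) (Fin 2) ℂ) - 1‖ ≤ max δc δin := by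
  intro b
  by_cases hb : b.src ∈ maxDomT M₁ Z 1
  · obtain ⟨p, hps, hdir⟩ := exists_plaq_fst_or_fourth (F := F) h2 b
    have hmem : (⟨p.src, p.μ⟩ : PBond (F.P Kt) 0) ∈ {b : PBond (F.P Kt) 0 | b.src ∈ maxDomT M₁ Z 1} := by
      show p.src ∈ maxDomT M₁ Z 1
      rw [hps]; exact hb
    obtain ⟨h₁, -, -, h₄⟩ := hC1 p (Or.inl hmem)
    rcases hdir with hμ | hν
    · have e : (⟨p.src, p.μ⟩ : PBond (F.P Kt) 0) = b := by rw [hps, hμ]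
      rw [e] at h₁
      exact h₁.trans (le_max_left _ _)
    · have e : (⟨p.src, p.ν⟩ : PBond (F.P Kt) 0) = b := by rw [hps, hν]
      rw [e] at h₄
      exact h₄.trans (le_max_left _ _)
  · have hb0 : b ∈ bondsOf (Bj M₁ Z k 0) := by
      rw [Bj_zero hk0]
      exact Or.inl hb
    have hin : b ∈ inputs (Bj M₁ Z k) := mem_inputs.2 ⟨0, b, hb0, by rw [feeds_zero]; exact Set.mem_singleton b⟩
    exact (hCin b hin).trans (le_max_right _ _)

/-- Bond-wise near-flatness `‖↑U₀ b − 1‖ ≤ δ` is `‖↑U₀ − 1‖ ≤ δ` in the sup norm of matrix fields (dag-n10-w1's currency). [cite: Balaban1989LargeFieldII, p.357 (bookkeeping)] -/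
theorem norm_coeField_sub_one_le {U₀ : GaugeField (F.P Kt) 0 SU2} {δ : ℝ} (hδ0 : 0 ≤ δ)
    (hU : ∀ b : PBond (F.P Kt) 0, ‖((U₀ b : SU2) : Matrix (Fin 2) (Fin 2) ℂ) - 1‖ ≤ δ) : ‖coeField U₀ - 1‖ ≤ δ :=
  (pi_norm_le_iff_of_nonneg hδ0).2 fun b => by
    rw [Pi.sub_apply, coeField_apply, Pi.one_apply]; exact hU b

/-! ## §2  The junction's seminorm `p := bond-ℓ²(HS)` (an explicit `Seminorm` term; no definition is introduced) -/

section L2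

variable {ι : Type} [Fintype ι] {N : ℕ}

/-- The bond-`ℓ²` (Hilbert–Schmidt) seminorm, written as the comp of the `PiLp 2` norm with the `WithLp` identification: `p(Y) = √(Σ_b ‖Y_b‖²)`.
[cite: Balaban1989LargeFieldII, (17)–(19) pp.360–361; Balaban1985Averaging, (17)–(19) pp.20–21 (bookkeeping)] -/
theorem l2Seminorm_apply (Y : ι → lieSU (Fin N)) :
    (normSeminorm ℝ (PiLp 2 (fun _ : ι => lieSU (Fin N)))).comp (WithLp.linearEquiv 2 ℝ (ι → lieSU (Fin N))).symm.toLinearMap Y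
      = Real.sqrt (∑ b, ‖Y b‖ ^ 2) := by
  rw [Seminorm.comp_apply, coe_normSeminorm, LinearEquiv.coe_coe, PiLp.norm_eq_of_L2]
  rfl

/-- `p(Y)² = Σ_b ‖Y_b‖²`. [cite: Balaban1985Averaging, (17)–(19) pp.20–21 (bookkeeping)] -/
theorem l2Seminorm_sq (Y : ι → lieSU (Fin N)) :
    (normSeminorm ℝ (PiLp 2 (fun _ : ι => lieSU (Fin N)))).comp (WithLp.linearEquiv 2 ℝ (ι → lieSU (Fin N))).symm.toLinearMap Y ^ 2 = ∑ b, ‖Y b‖ ^ 2 := by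
  rw [l2Seminorm_apply, Real.sq_sqrt (Finset.sum_nonneg fun b _ => sq_nonneg _)]

/-- J-C's `hp`: `Σ_b ‖↑Y_b‖²_op ≤ p(Y)²` (operator norm ≤ Hilbert–Schmidt norm on `𝔰𝔲(N)`, dag-n12-w2). [cite: Balaban1989LargeFieldII, (1.7) p.358; Balaban1985Averaging, (17) p.20] -/
theorem sum_opNorm_sq_le_l2Seminorm_sq [NeZero N] {P : Params} {j : ℕ} (Y : PBond P j → lieSU (Fin N)) :
    ∑ b, ‖(Y b : Matrix (Fin N) (Fin N) ℂ)‖ ^ 2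
      ≤ (normSeminorm ℝ (PiLp 2 (fun _ : PBond P j => lieSU (Fin N)))).comp (WithLp.linearEquiv 2 ℝ (PBond P j → lieSU (Fin N))).symm.toLinearMap Y ^ 2 := by
  rw [l2Seminorm_sq]
  exact sum_opNorm_coe_sq_le_sum_norm_sq Y

/-- The `ℓ¹(op)` size of the current letter against `p`: `Σ_b ‖↑Y_b‖_op ≤ √#bonds · p(Y)` (Cauchy–Schwarz). [cite: Balaban1985Averaging, (17)–(19) pp.20–21 (bookkeeping)] -/
theorem sum_opNorm_le_sqrt_card_mul_l2Seminorm [NeZero N] {P : Params} {j : ℕ} (Y : PBond P j → lieSU (Fin N)) :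
    ∑ b, ‖(Y b : Matrix (Fin N) (Fin N) ℂ)‖
      ≤ Real.sqrt (Fintype.card (PBond P j)) *
        (normSeminorm ℝ (PiLp 2 (fun _ : PBond P j => lieSU (Fin N)))).comp (WithLp.linearEquiv 2 ℝ (PBond P j → lieSU (Fin N))).symm.toLinearMap Y := by
  rw [l2Seminorm_apply]
  have h1 : ∑ b, ‖(Y b : Matrix (Fin N) (Fin N) ℂ)‖ ≤ ∑ b, ‖Y b‖ := Finset.sum_le_sum fun b _ => opNorm_coe_le_norm_lieSU (Y b)
  have hcs : (∑ b, ‖Y b‖) ^ 2 ≤ (Fintype.card (PBond P j) : ℝ) * ∑ b, ‖Y b‖ ^ 2 := by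
    have h := sq_sum_le_card_mul_sum_sq (s := (Finset.univ : Finset (PBond P j))) (f := fun b => ‖Y b‖)
    simpa [Finset.card_univ] using h
  have h2 : ∑ b, ‖Y b‖ ≤ Real.sqrt (Fintype.card (PBond P j)) * Real.sqrt (∑ b, ‖Y b‖ ^ 2) := by
    rw [← Real.sqrt_mul (Nat.cast_nonneg _), ← Real.sqrt_sq (Finset.sum_nonneg fun b _ => norm_nonneg (Y b))]
    exact Real.sqrt_le_sqrt hcs
  exact h1.trans h2

/-- `p(Y) ≤ √#bonds · ‖Y‖` (sup norm). [cite: Balaban1985Averaging, (17)–(19) pp.20–21 (bookkeeping)] -/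
theorem l2Seminorm_le_sqrt_card_mul_norm (Y : ι → lieSU (Fin N)) :
    (normSeminorm ℝ (PiLp 2 (fun _ : ι => lieSU (Fin N)))).comp (WithLp.linearEquiv 2 ℝ (ι → lieSU (Fin N))).symm.toLinearMap Y
      ≤ Real.sqrt (Fintype.card ι) * ‖Y‖ := by
  rw [l2Seminorm_apply, ← Real.sqrt_sq (norm_nonneg Y), ← Real.sqrt_mul (Nat.cast_nonneg _)]
  refine Real.sqrt_le_sqrt ?_
  calc ∑ b, ‖Y b‖ ^ 2 ≤ ∑ _b : ι, ‖Y‖ ^ 2 := Finset.sum_le_sum fun b _ => by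
          have := norm_le_pi_norm Y b
          exact pow_le_pow_left₀ (norm_nonneg _) this 2
    _ = (Fintype.card ι : ℝ) * ‖Y‖ ^ 2 := by rw [Finset.sum_const, Finset.card_univ, nsmul_eq_mul]

/-- (K) in `p`-currency from a per-bond bound and a support letter: if `‖Y_b‖ ≤ a` for all `b` and `Y` vanishes off the bonds sourced in `S`, then `p(Y) ≤ √#{b | b.src ∈ S} · a`.
[cite: Balaban1989LargeFieldII, (1.13) p.359; Balaban1985Averaging, (17)–(19) pp.20–21 (bookkeeping)] -/
theorem l2Seminorm_le_of_bound_of_support {P : Params} {j : ℕ} (S : Set (Site P j)) (Y : PBond P j → lieSU (Fin N)) {a : ℝ} (ha : 0 ≤ a)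
    (hb : ∀ b, ‖Y b‖ ≤ a) (hs : ∀ b : PBond P j, b.src ∉ S → Y b = 0) :
    (normSeminorm ℝ (PiLp 2 (fun _ : PBond P j => lieSU (Fin N)))).comp (WithLp.linearEquiv 2 ℝ (PBond P j → lieSU (Fin N))).symm.toLinearMap Y
      ≤ Real.sqrt (Nat.card {b : PBond P j // b.src ∈ S}) * a := by
  classical
  rw [l2Seminorm_apply, ← Real.sqrt_sq ha, ← Real.sqrt_mul (Nat.cast_nonneg _)]
  refine Real.sqrt_le_sqrt ?_
  have hsplit : ∑ b, ‖Y b‖ ^ 2 = ∑ b ∈ Finset.univ.filter (fun b : PBond P j => b.src ∈ S), ‖Y b‖ ^ 2 := by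
    rw [Finset.sum_filter]
    refine Finset.sum_congr rfl fun b _ => ?_
    split_ifs with h
    · rfl
    · rw [hs b h, norm_zero]; simp
  rw [hsplit]
  have hcard : ((Finset.univ.filter (fun b : PBond P j => b.src ∈ S)).card : ℝ) = (Nat.card {b : PBond P j // b.src ∈ S} : ℝ) := by
    rw [Nat.card_eq_fintype_card, Fintype.card_subtype]
  calc ∑ b ∈ Finset.univ.filter (fun b : PBond P j => b.src ∈ S), ‖Y b‖ ^ 2
      ≤ ∑ _b ∈ Finset.univ.filter (fun b : PBond P j => b.src ∈ S), a ^ 2 :=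
        Finset.sum_le_sum fun b _ => pow_le_pow_left₀ (norm_nonneg _) (hb b) 2
    _ = (Nat.card {b : PBond P j // b.src ∈ S} : ℝ) * a ^ 2 := by rw [Finset.sum_const, nsmul_eq_mul, hcard]

end L2

end Summit.QuantumFields.YangMills.BalabanUVNodes.N12NearFlatChartLetter

end
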